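import Mathlib
import Summits.ValiantsHypothesis.ValiantsHypothesis.Theorems.GrenetZeonTwoDimCoefficientsScalingIndexSeparable

/-!
# Crux `GrenetZeon.TwoDimCoefficients` (stmt-ValiantsHypothesis-8062), stub `stub_dualUnipotent`:
# scaling-closure — separability over the FUNCTION FIELD yields the certificate (R9′), and the index-`n` 3/2 rung restated

✓ `cube_le_two_mul_sq_of_index_separable` / ✓ `cube_le_two_mul_sq_of_raySeparable` take a separability CERTIFICATE
`a·R + b·R′ = g`, `0 ≠ g ∈ ℂ[z]`, `a, b ∈ ℂ[z][t]`.  Clearing denominators (✓ `IsLocalization.integerNormalization`) shows that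
such a certificate exists as soon as `R` is separable over the fraction field `ℂ(z)`:

* `exists_certificate_of_separable_map` — for a domain `S` with fraction field `K` and `p ∈ S[t]`: `p` separable in `K[t]`
  ⟹ `∃ a b g, g ≠ 0 ∧ a·p + b·p′ = C g`;
* ★★ `cube_le_two_mul_sq_of_index_separableFrac` — INDEX-`n` normal form (`A = A₀(1 − N)`, `Nⁿ = 0`, `B` affine,
  `det A = c ≠ 0`, `per_n = α·c + β·tr(adj A·B)`) whose polynomial `c·det(1_m + t·c⁻¹P^top)` (`P^top` = degree-`n` part of
  `adj A·B`) is SEPARABLE over `ℂ(z)` ⟹ `n³ ≤ 2m²` (crux `DualUnipotentThreeHalves`, stmt-24318, constant `2`).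

In characteristic `0` separable = squarefree, so the 3/2 rung holds for every index-`n` pencil — wild or not — off the
locus where `det(1_m + t·Y(z))` has a repeated factor; that locus is the whole remaining content of lemma L1′ (memo
SEVENTEENTH-HAND.md).

HONEST FRAMING: a conditional rung; the stub `DualUnipotentBound`, both cruxes and `VP ≠ VNP` remain open.

References: T. Mignon, N. Ressayre, Int. Math. Res. Not. 2004:79, Thm. 1.1 (via the tree); folklore.
-/

-- single-conjunct layout `Summits/ValiantsHypothesis/ValiantsHypothesis`: the duplicated namespace
-- component is mandated by the tree.
set_option linter.dupNamespace false
set_option autoImplicit false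

noncomputable section

namespace Summit.ValiantsHypothesis.ValiantsHypothesis.Theorems.GrenetZeonTwoDimCoefficients.ScalingClosure

open MvPolynomial Matrix
open Literature.Computability.AlgebraicComplexity
open Summit.ValiantsHypothesis.ValiantsHypothesis.Cruxes.TwoDimCoefficients.DimTwoCases

section Certificate

variable {S : Type*} [CommRing S] [IsDomain S] {K : Type*} [Field K] [Algebra S K] [IsFractionRing S K]

/-- **Clearing denominators in a Bézout identity.**  If `p ∈ S[t]` becomes separable over the fraction field `K` of the
domain `S`, then `a·p + b·p′ = C g` for some `a, b ∈ S[t]` and `0 ≠ g ∈ S`. [folklore] -/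
theorem exists_certificate_of_separable_map (p : Polynomial S)
    (hsep : (p.map (algebraMap S K)).Separable) :
    ∃ (a b : Polynomial S) (g : S), g ≠ 0 ∧ a * p + b * Polynomial.derivative p = Polynomial.C g := by
  obtain ⟨u, v, huv⟩ := hsep
  obtain ⟨su, hsuM, hsu⟩ := IsLocalization.integerNormalization_spec (nonZeroDivisors S) (S := K) u
  obtain ⟨sv, hsvM, hsv⟩ := IsLocalization.integerNormalization_spec (nonZeroDivisors S) (S := K) v
  refine ⟨Polynomial.C sv * IsLocalization.integerNormalization (nonZeroDivisors S) u,
    Polynomial.C su * IsLocalization.integerNormalization (nonZeroDivisors S) v, su * sv,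
    mul_ne_zero (nonZeroDivisors.ne_zero hsuM) (nonZeroDivisors.ne_zero hsvM), ?_⟩
  apply Polynomial.map_injective (algebraMap S K) (IsFractionRing.injective S K)
  rw [Polynomial.map_add, Polynomial.map_mul, Polynomial.map_mul, Polynomial.map_mul, Polynomial.map_mul,
    Polynomial.map_C, Polynomial.map_C, hsu, hsv, ← Polynomial.derivative_map, Polynomial.map_C, map_mul]
  calc Polynomial.C (algebraMap S K sv) * (su • u) * p.map (algebraMap S K) +
        Polynomial.C (algebraMap S K su) * (sv • v) * Polynomial.derivative (p.map (algebraMap S K))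
      = Polynomial.C (algebraMap S K su) * Polynomial.C (algebraMap S K sv) *
          (u * p.map (algebraMap S K) + v * Polynomial.derivative (p.map (algebraMap S K))) := by
        rw [Algebra.smul_def, Algebra.smul_def, Polynomial.algebraMap_apply, Polynomial.algebraMap_apply]
        ring
    _ = Polynomial.C (algebraMap S K su * algebraMap S K sv) := by
        rw [huv, mul_one, ← Polynomial.C_mul]

end Certificate

section IndexFrac

/-- ★★ **Index-`n` pencils with separable `det(1 + t·Y)` obey `n³ ≤ 2m²`** (`n = k + 3`, `m ≥ 2`): as
✓ `cube_le_two_mul_sq_of_index_separable`, with the certificate replaced by separability of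
`R = c·det(1 − t·(−c⁻¹P^top))` over the fraction field of `ℂ[z]`. [cite: MignonRessayre2004, Thm. 1.1 — via the tree; folklore] -/
theorem cube_le_two_mul_sq_of_index_separableFrac {k m : ℕ} (A B : AffMat (k + 3) m) (hA : IsAffine A)
    (hB : IsAffine B) (α β c : ℂ) (hc : c ≠ 0) (hβ : β ≠ 0) (hdet : A.det = MvPolynomial.C c)
    (hper : perPoly (Fin (k + 3)) ℂ =
      MvPolynomial.C α * A.det + MvPolynomial.C β * (A.adjugate * B).trace)
    (hm2 : 2 ≤ m) (A₀ P₀ : Matrix (Fin m) (Fin m) ℂ) (hP₀ : A₀ * P₀ = 1) (N : AffMat (k + 3) m)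
    (hN : ∀ i j, (N i j).IsHomogeneous 1) (hNn : N ^ (k + 3) = 0) (hAN : A = A₀.map MvPolynomial.C * (1 - N))
    (Ptop : AffMat (k + 3) m) (htop : ∀ i j, Ptop i j = homogeneousComponent (k + 3) ((A.adjugate * B) i j))
    (hsep : ((Polynomial.C (MvPolynomial.C c) *
        (-((MvPolynomial.C c⁻¹ : MvPolynomial (Fin (k + 3) × Fin (k + 3)) ℂ) • Ptop)).charpolyRev).map
        (algebraMap (MvPolynomial (Fin (k + 3) × Fin (k + 3)) ℂ)
          (FractionRing (MvPolynomial (Fin (k + 3) × Fin (k + 3)) ℂ)))).Separable) :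
    (k + 3) ^ 3 ≤ 2 * m ^ 2 := by
  obtain ⟨a, b, g, hg, hcert⟩ := exists_certificate_of_separable_map _ hsep
  exact cube_le_two_mul_sq_of_index_separable A B hA hB α β c hc hβ hdet hper hm2 A₀ P₀ hP₀ N hN hNn hAN Ptop htop
    a b g hg hcert

end IndexFrac

end Summit.ValiantsHypothesis.ValiantsHypothesis.Theorems.GrenetZeonTwoDimCoefficients.ScalingClosure

end
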